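import Summits.BirchSwinnertonDyer.Rank1Residual.Additive.GordRankOneKatoCertificateThreeBSD
import Summits.BirchSwinnertonDyer.Rank1Residual.Additive.GordBranchPAdicGrossZagierOdd
import Summits.BirchSwinnertonDyer.Rank1Residual.Additive.ReductionNonAnomalousTwist
import HarnessLib

/-!
# O7-ord at `p = 3` on the (G)-ordinary defect-`2` CERTIFICATE rows: the typed `3`-adic
# Gross–Zagier on the odd branch ⟺ `BSD(E,3)` (cell `b2b-bsdres`, team n1011, seat p12 (gen 2),
# row T-O7c (iii) — lead GEN 5 R5-22(d): "the odd-branch converse AT `p = 3` off the anomalous rows,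
# a corollary of p12's `ClassX4Gord.bsdp_three_iff_padicVal_rankOne_of_katoHalf_of_norm_coeff_one`")

HONEST FRAMING (cell `b2b-bsdres`, run/shared/lean/b2b/bsd-rank1-residual/, verbatim in every
file): the goal of the cell is to DELETE the COMBINATION-SHAPED residual classes of the
Birch–Swinnerton-Dyer formula for ALL analytic-rank `≤ 1` elliptic curves over `ℚ` — "full BSD
formula for every rank `≤ 1` curve in class `C`" assembled STRICTLY from published theorems — so
that the rank-`≤ 1` remainder becomes exactly the CONSTRUCTION-SHAPED classes, which are TYPED
(missing-input `Prop`s), NOT attempted. This is not "finishing BSD". Team n1011 (RESIDUAL-MAP §I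
O7-ord at `p = 3`), seat `b2b-bsdres-n1011-p12` (gen 2): research route on the CONSTRUCTION-SHAPED
class O7; labels and marks UNCHANGED; nothing booked; NO Literature fact minted; no definition.
THEOREMS ONLY; named facts are explicit HYPOTHESES (`hK` Kato 2004 Thm. 17.4 (3) half-eigenspace
reading / `hWu` Wuthrich 2014 Thm. 16 on the X3 twin; `hGZK`; `hmod`/`hmodD`); the per-pair inputs
are additive-p2's typed certificate `BranchUnitCertificateAt W 3` (ONE `3`-adic unit) and a Delbourgo
(B)-datum `hB : LeadingTermClauses W 3 Dh`; the row binder `hna : ReductionNonAnomalous W 3` is DECIDABLE per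
pair by n1011-p10's B6 (`reductionNonAnomalous_iff_not_dvd_frobeniusTrace_sub_one_of_semistabilityIndex_eq_two`:
`a₃(E^{(−3)}) ∉ {1, −2}`; the `…_of_not_dvd` record form is the sequel, once that module is built on
the farm).

## What and why

Seat p01 typed the `ω^{(p−1)/2}`-branch `p`-adic Gross–Zagier at an additive prime
(`BranchPAdicGrossZagierOddAt W p Dh`: `L^{(r)}(E,1)/r! = q·Ω_E·Reg_∞` and
`ϖ·[T^r]B⁻·log_p(γ)^r = u·q·Reg_p(E,Dh)`, `u ∈ ℤ_p^×`) and proved, with p07's branch-IMC LOWER input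
and Kato's UPPER, both directions "`p`-adic GZ ⟺ `BSD(E,p)`" (`GordBranchPAdicGrossZagierOdd[Converse].lean`;
the converse includes `p = 3`). THIS FILE is the CERTIFICATE-row version AT `p = 3`, which needs NO
branch-IMC lower input: on X4♯(G-ord)@3 ∩ {`ρ̄_{E,3}` onto} (resp. X3♯(G-ord)@3), `r_an = 1`,
non-anomalous, given Kato's (resp. Wuthrich's) divisibility and the ONE-NUMBER certificate
(`‖ϖ·[T¹]B⁻₁(f_{E^{(−3)}}, α₃)‖₃ = 1` for every admissible tuple), for every (B)-datum `Dh`: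

  **`BranchPAdicGrossZagierOddAt W 3 Dh ⟺ BSDp W 3`**
  (`ClassX4Gord.branchPAdicGrossZagierOddAt_three_iff_bsdp_of_katoHalf_of_cert`, X3 twin
  `ClassX3Gord.…_of_wuthrichHalf_of_cert`).

Proof (pure valuation bookkeeping over this seat's `ClassX4Gord.bsdp_three_iff_padicVal_rankOne_of_katoHalf_of_cert`:
`BSDp W 3 ↔ ord₃ q + ord₃ Reg₃(E,Dh) = 1`): the certificate pins `ord₃(ϖ·[T¹]B⁻) = 0` and
`ord₃ log₃(γ) = 1`, so the `3`-adic GZ identity holds with a UNIT `u` iff `ord₃ q + ord₃ Reg₃ = 1`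
(`Reg₃ ≠ 0` PROVED on these rows — Schneider from the certificate; `q ≠ 0` by modularity). So on the
certificate rows p01's typed `3`-adic Gross–Zagier is EXACTLY `BSD(E,3)` — its valuation content — and
nothing stronger; the per-pair residue of O7-ord@3 is numerical (R3-S3 tightness, route planner 3).
Nothing booked; O7 stays CONSTRUCTION-SHAPED.

References: [Delbourgo2002] Thm. (B) (p. 40); [Kato2004Asterisque] Thm. 17.4 (3); [Wuthrich2014]
Thm. 16, Lemma 20; [MazurTateTeitelbaum1986Invent] §I.13–I.14; [Miller2011LMS] Def. 1.1;
[PerrinRiou1987] §1.4 (shape); [Iwasawa1972PadicL] §4.4 (`log_p(1+p) = p·unit`).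
-/

noncomputable section

open scoped Classical MatrixGroups ModularForm NumberField

namespace Summit.BirchSwinnertonDyer.Rank1Residual.Additive

open CongruenceSubgroup WeierstrassCurve NumberField Literature.NumberTheory.EllipticCurves
  Literature.NumberTheory.EllipticCurves.ModularForms
  Literature.NumberTheory.EllipticCurves.Rank1Residual
  Literature.NumberTheory.EllipticCurves.Rank1Residual.Typed
  Literature.NumberTheory.EllipticCurves.Delbourgo2002
  Literature.NumberTheory.GaloisRepresentations Summit.BirchSwinnertonDyer.Rank1Residual.AdditivePotMult
  Summit.BirchSwinnertonDyer.Rank1Residual.X1.MuLambda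
  Summit.BirchSwinnertonDyer.Rank1Residual.X1.RankOneParitySqueeze
  IsDedekindDomain

/-! ### §0 Valuation bookkeeping in `ℚ_p` -/

section Valuation

variable {p : ℕ} [hp : Fact p.Prime]

/-- For `x ∈ ℚ_p` of valuation `1`, a non-zero rational `q` and a non-zero `R ∈ ℚ_p`:
`x = u·q·R` for some `u ∈ ℤ_p^×` iff `ord_p q + ord_p R = 1`. [folklore] -/
private theorem exists_unit_mul_iff_padicValRat_add_valuation_eq_one {x R : ℚ_[p]} {q : ℚ}
    (hx : x.valuation = 1) (hq0 : q ≠ 0) (hR0 : R ≠ 0) :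
    (∃ u : ℤ_[p]ˣ, x = ((u : ℤ_[p]) : ℚ_[p]) * (q : ℚ_[p]) * R) ↔
      padicValRat p q + R.valuation = 1 := by
  have hqQ : ((q : ℚ) : ℚ_[p]) ≠ 0 := by exact_mod_cast hq0
  have hqR : (q : ℚ_[p]) * R ≠ 0 := mul_ne_zero hqQ hR0
  constructor
  · rintro ⟨u, hu⟩
    have hval := congrArg Padic.valuation hu
    rw [hx, mul_assoc, Padic.valuation_mul (coe_units_ne_zero p u) hqR, valuation_coe_units_eq_zero,
      Padic.valuation_mul hqQ hR0, Padic.valuation_ratCast] at hval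
    linarith
  · intro h
    have hx0 : x ≠ 0 := by
      intro h0
      have : (0 : ℚ_[p]).valuation = 1 := by rw [← h0]; exact hx
      simp at this
    set u' : ℚ_[p] := x * ((q : ℚ_[p]) * R)⁻¹ with hu'_def
    have hxu : x = u' * ((q : ℚ_[p]) * R) := by
      rw [hu'_def, mul_assoc, inv_mul_cancel₀ hqR, mul_one]
    have hu'0 : u' ≠ 0 := by
      intro h0; rw [h0, zero_mul] at hxu; exact hx0 hxu
    have hvu : u'.valuation = 0 := by
      have hval := congrArg Padic.valuation hxu
      rw [hx, Padic.valuation_mul hu'0 hqR, Padic.valuation_mul hqQ hR0, Padic.valuation_ratCast] at hval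
      linarith
    have hnorm : ‖u'‖ = 1 := by
      rw [Padic.norm_eq_zpow_neg_valuation hu'0, hvu, neg_zero, zpow_zero]
    obtain ⟨u, hu⟩ := exists_unit_coe_eq_of_norm_eq_one p hnorm
    exact ⟨u, by rw [hu, mul_assoc]; exact hxu⟩

/-- The certificate pins the valuation: `‖c‖ = 1` and `log_p(γ) = p·unit` (`p` odd) give
`ord_p (c · log_p γ) = 1`. [cite: Iwasawa1972PadicL, §4.4] -/
private theorem valuation_mul_padicLog_eq_one (hp2 : p ≠ 2) {c : ℚ_[p]} (hc : ‖c‖ = 1) :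
    (c * padicLog p (cyclotomicGenerator p : ℚ_[p])).valuation = 1 := by
  obtain ⟨w, hw⟩ := exists_unit_coe_eq_of_norm_eq_one p hc
  obtain ⟨v, hv⟩ := exists_unit_padicLog_cyclotomicGenerator p hp2
  have hpQ : (p : ℚ_[p]) ≠ 0 := Nat.cast_ne_zero.mpr hp.out.ne_zero
  rw [← hw, hv, Padic.valuation_mul (coe_units_ne_zero p w) (mul_ne_zero hpQ (coe_units_ne_zero p v)),
    valuation_coe_units_eq_zero, Padic.valuation_mul hpQ (coe_units_ne_zero p v), Padic.valuation_p,
    valuation_coe_units_eq_zero]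
  ring

omit hp in
/-- `BSDp W p` in analytic rank `≤ 1` yields the rational `q` of `L^{(r)}(E,1)/r! = q·Ω_E·Reg_∞(E)`
(`q = #Ш_an·∏c/#tors²`). [cite: Miller2011LMS, Def. 1.1] -/
private theorem exists_leadingLCoeff_eq_of_bsdp {W : WeierstrassCurve ℚ} [W.IsElliptic]
    (hbsd : BSDp W p) :
    ∃ q : ℚ, W.leadingLCoeff = (q : ℂ) * (W.realPeriodRat : ℂ) * (W.regulator : ℂ) := by
  obtain ⟨-, -, s, hs, -⟩ := hbsd
  have hΩC : (W.realPeriodRat : ℂ) ≠ 0 := by exact_mod_cast W.realPeriodRat_pos_holds.ne'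
  have hRegC : (W.regulator : ℂ) ≠ 0 := by exact_mod_cast (regulator_pos_holds W).ne'
  have hTC : (W.torsionOrder : ℂ) ≠ 0 := by exact_mod_cast (W.torsionOrder_pos_holds).ne'
  have hPC : (W.tamagawaProduct : ℂ) ≠ 0 := by
    exact_mod_cast (W.tamagawaProduct_pos_holds : 0 < W.tamagawaProduct).ne'
  refine ⟨s * (W.tamagawaProduct : ℚ) / (W.torsionOrder : ℚ) ^ 2, ?_⟩
  have h := hs
  rw [shaAn_def, div_eq_iff (mul_ne_zero (mul_ne_zero hΩC hPC) hRegC)] at h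
  push_cast
  field_simp
  linear_combination h

end Valuation

/-! ### §1 X4♯(G-ord)@3 certificate rows: typed `3`-adic Gross–Zagier (odd branch) ⟺ `BSD(E,3)` -/

section Three

variable {W : WeierstrassCurve ℚ} [W.IsElliptic] [W.IsGloballyMinimal] [hp : Fact (Nat.Prime 3)]

/-- **T-O7c (iii): O7-ord@3 ∩ X4♯(G-ord) ∩ {`ρ̄_{E,3}` onto}, `r_an = 1`, NON-ANOMALOUS, on the
certificate rows — for every Delbourgo (B)-datum `Dh`: p01's typed `3`-adic Gross–Zagier on the odd
branch ⟺ `BSD(E,3)`.** Inputs: Kato's half-eigenspace divisibility `hK` (published), the ONE-NUMBER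
certificate `BranchUnitCertificateAt W 3`, `hB`, GZK, modularity. (⟹) at the admissible tuple of the
good-ordinary twist model the certificate gives `ord₃(ϖ·[T¹]B⁻·log₃γ) = 1`, so `u·q·Reg₃` has
valuation `1`, i.e. `ord₃ q + ord₃ Reg₃ = 1`, which is `BSD₃` by this seat's
`ClassX4Gord.bsdp_three_iff_padicVal_rankOne_of_katoHalf_of_cert`; (⟸) `BSD₃` gives
`ord₃ q + ord₃ Reg₃ = 1` (same theorem; `q` from `#Ш_an`), and for EVERY admissible tuple the
certificate makes `(ϖ·[T¹]B⁻·log₃γ)/(q·Reg₃)` a `3`-adic unit. `Reg₃(E,Dh) ≠ 0` is PROVED (Schneider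
from the certificate), NOT assumed; NO branch-IMC lower input, NO Pal, NO tower binder.
[cite: Delbourgo2002, Theorem (B) (p. 40)] [cite: Kato2004Asterisque, Thm. 17.4 (3) (p. 273)]
[cite: Miller2011LMS, Def. 1.1] [cite: MazurTateTeitelbaum1986Invent, §I.13–I.14] -/
theorem ClassX4Gord.branchPAdicGrossZagierOddAt_three_iff_bsdp_of_katoHalf_of_cert
    (hK : Wuthrich2014.kato_halfEigenCharIdeal_dvd_cyclotomicPrime_of_surjective)
    (hmodD : nonempty_modularParametrizationData)
    (hGZK : rank_eq_analyticRank_of_analyticRank_le_one) (hmod : hasEntireLFunction_rat)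
    (hX : ClassX4Gord W 3) (hsurj : Surj W 3) (hr : W.analyticRank = 1)
    (hna : ReductionNonAnomalous W 3) (hcert : BranchUnitCertificateAt W 3)
    {Dh : PAdicHeightData W 3} (hB : LeadingTermClauses W 3 Dh) :
    BranchPAdicGrossZagierOddAt W 3 Dh ↔ BSDp W 3 := by
  have hodd : ¬ Even (3 / 2) := by decide
  have hmw : W.mordellWeilRank = 1 := (hGZK W hr.le).1.trans hr
  have hS : SchneiderConjecture Dh :=
    (hX.schneider_and_padicVal_identity_three_of_katoHalf_of_cert hK hmodD hGZK hsurj hr hcert hB).1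
  have hReg0 : padicRegulator Dh ≠ 0 := hS
  have hL0 : W.leadingLCoeff ≠ 0 := W.leadingLCoeff_ne_zero_holds (hmod W)
  -- the valuation pinned by the certificate, for any admissible tuple
  have hval : ∀ (V : WeierstrassCurve ℚ) [V.IsElliptic] [V.IsGloballyMinimal] (C : VariableChange ℚ),
      C • V.quadraticTwist ((-1 : ℚ) ^ (3 / 2) * (3 : ℕ)) = W → GoodOrd V 3 →
      ∀ {N : ℕ} [NeZero N] (f : CuspForm (Gamma0 N) 2), IsNewformOf V f → ∀ ϖ : ℚ,
        (ϖ : ℝ) * V.imaginaryPeriodRat = minusPeriod f →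
        (((ϖ : ℚ) : ℚ_[3]) *
            PowerSeries.coeff 1 (padicLFunctionMinusBranch f ((unitRoot V 3 : ℤ_[3]) : ℚ_[3]) (3 / 2)) *
          padicLog 3 (cyclotomicGenerator 3 : ℚ_[3])).valuation = 1 := by
    intro V _ _ C hC hord N _ f hf ϖ hϖ
    obtain ⟨-, h1⟩ := hcert V C hC hord f hf ϖ (by rw [if_neg hodd]; exact hϖ)
    rw [if_neg hodd, PowerSeries.coeff_C_mul] at h1
    exact valuation_mul_padicLog_eq_one (by decide) h1
  constructor
  · -- (⟹): evaluate the typed identity at the good-ordinary twist model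
    intro hGZ
    have he : semistabilityIndex W 3 = 2 :=
      semistabilityIndex_eq_two_of_typeG_three W hX.typeGOrd.typeG hX.addv.2
    obtain ⟨V, iV, iVm, C, hV, hC⟩ := hX.exists_goodOrd_pStar_twist_model W 3 he
    haveI : NeZero (V.conductorNorm ℤ) := ⟨(V.conductorNorm_pos_holds).ne'⟩
    obtain ⟨Dm⟩ := hmodD V
    obtain ⟨ϖ, -, hϖ⟩ := exists_rat_mul_imaginaryPeriodRat_eq_minusPeriod Dm
    have hVW : ∃ C : VariableChange ℚ, C • V.quadraticTwist (-((3 : ℕ) : ℚ)) = W :=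
      ⟨C, by have h := hC; norm_num at h ⊢; exact h⟩
    obtain ⟨u, q, hLq, hid⟩ := hGZ V (by norm_num) hVW hV Dm.isNewformOf ϖ hϖ
    rw [hmw, pow_one] at hid
    have hq0 : q ≠ 0 := by
      rintro rfl
      rw [Rat.cast_zero, zero_mul, zero_mul] at hLq
      exact hL0 hLq
    have h1 := hval V C hC hV Dm.f Dm.isNewformOf ϖ hϖ
    have hv : padicValRat 3 q + (padicRegulator Dh).valuation = 1 :=
      (exists_unit_mul_iff_padicValRat_add_valuation_eq_one h1 hq0 hReg0).mp ⟨u, hid⟩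
    exact (hX.bsdp_three_iff_padicVal_rankOne_of_katoHalf_of_cert hK hmodD hGZK hmod hsurj hr hna hcert
      hB hLq).mpr hv
  · -- (⟸): `BSD₃` pins `ord₃ q + ord₃ Reg₃ = 1`; the certificate supplies the unit for every tuple
    intro hbsd
    obtain ⟨q, hLq⟩ := exists_leadingLCoeff_eq_of_bsdp hbsd
    have hq0 : q ≠ 0 := by
      rintro rfl
      rw [Rat.cast_zero, zero_mul, zero_mul] at hLq
      exact hL0 hLq
    have hv : padicValRat 3 q + (padicRegulator Dh).valuation = 1 :=
      (hX.bsdp_three_iff_padicVal_rankOne_of_katoHalf_of_cert hK hmodD hGZK hmod hsurj hr hna hcert hB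
        hLq).mp hbsd
    intro V _ _ N _ f hp4 hVW hord hf ϖ hϖ
    obtain ⟨C, hC⟩ := hVW
    have hC' : C • V.quadraticTwist ((-1 : ℚ) ^ (3 / 2) * (3 : ℕ)) = W := by
      have h := hC; norm_num at h ⊢; exact h
    have h1 := hval V C hC' hord f hf ϖ hϖ
    obtain ⟨u, hu⟩ := (exists_unit_mul_iff_padicValRat_add_valuation_eq_one h1 hq0 hReg0).mpr hv
    refine ⟨u, q, hLq, ?_⟩
    rw [hmw, pow_one]
    exact hu

/-- **X3♯(G-ord)@3 twin** (reducible `E[3]`; Wuthrich 2014 Thm. 16 `hWu` in place of Kato; NO surj):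
on the certificate rows, `r_an = 1`, non-anomalous, for every (B)-datum:
`BranchPAdicGrossZagierOddAt W 3 Dh ⟺ BSDp W 3`. [cite: Delbourgo2002, Theorem (B) (p. 40)]
[cite: Wuthrich2014, Thm. 16 (p. 397)] [cite: Miller2011LMS, Def. 1.1] -/
theorem ClassX3Gord.branchPAdicGrossZagierOddAt_three_iff_bsdp_of_wuthrichHalf_of_cert
    (hWu : Wuthrich2014.thm16_halfEigenCharIdeal_dvd_cyclotomicPrime)
    (hmodD : nonempty_modularParametrizationData)
    (hGZK : rank_eq_analyticRank_of_analyticRank_le_one) (hmod : hasEntireLFunction_rat)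
    (hX : ClassX3Gord W 3) (hr : W.analyticRank = 1)
    (hna : ReductionNonAnomalous W 3) (hcert : BranchUnitCertificateAt W 3)
    {Dh : PAdicHeightData W 3} (hB : LeadingTermClauses W 3 Dh) :
    BranchPAdicGrossZagierOddAt W 3 Dh ↔ BSDp W 3 := by
  have hodd : ¬ Even (3 / 2) := by decide
  have hmw : W.mordellWeilRank = 1 := (hGZK W hr.le).1.trans hr
  have hS : SchneiderConjecture Dh :=
    (hX.schneider_and_padicVal_identity_three_of_wuthrichHalf_of_cert hWu hmodD hGZK hr hcert hB).1
  have hReg0 : padicRegulator Dh ≠ 0 := hS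
  have hL0 : W.leadingLCoeff ≠ 0 := W.leadingLCoeff_ne_zero_holds (hmod W)
  have hval : ∀ (V : WeierstrassCurve ℚ) [V.IsElliptic] [V.IsGloballyMinimal] (C : VariableChange ℚ),
      C • V.quadraticTwist ((-1 : ℚ) ^ (3 / 2) * (3 : ℕ)) = W → GoodOrd V 3 →
      ∀ {N : ℕ} [NeZero N] (f : CuspForm (Gamma0 N) 2), IsNewformOf V f → ∀ ϖ : ℚ,
        (ϖ : ℝ) * V.imaginaryPeriodRat = minusPeriod f →
        (((ϖ : ℚ) : ℚ_[3]) *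
            PowerSeries.coeff 1 (padicLFunctionMinusBranch f ((unitRoot V 3 : ℤ_[3]) : ℚ_[3]) (3 / 2)) *
          padicLog 3 (cyclotomicGenerator 3 : ℚ_[3])).valuation = 1 := by
    intro V _ _ C hC hord N _ f hf ϖ hϖ
    obtain ⟨-, h1⟩ := hcert V C hC hord f hf ϖ (by rw [if_neg hodd]; exact hϖ)
    rw [if_neg hodd, PowerSeries.coeff_C_mul] at h1
    exact valuation_mul_padicLog_eq_one (by decide) h1
  constructor
  · intro hGZ
    have he : semistabilityIndex W 3 = 2 :=
      semistabilityIndex_eq_two_of_typeG_three W hX.typeGOrd.typeG hX.addv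
    obtain ⟨V, iV, iVm, C, hV, hC⟩ :=
      TypeGOrd.exists_goodOrd_pStar_twist_model W 3 (by decide) hX.typeGOrd hX.addv he
    haveI : NeZero (V.conductorNorm ℤ) := ⟨(V.conductorNorm_pos_holds).ne'⟩
    obtain ⟨Dm⟩ := hmodD V
    obtain ⟨ϖ, -, hϖ⟩ := exists_rat_mul_imaginaryPeriodRat_eq_minusPeriod Dm
    have hVW : ∃ C : VariableChange ℚ, C • V.quadraticTwist (-((3 : ℕ) : ℚ)) = W :=
      ⟨C, by have h := hC; norm_num at h ⊢; exact h⟩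
    obtain ⟨u, q, hLq, hid⟩ := hGZ V (by norm_num) hVW hV Dm.isNewformOf ϖ hϖ
    rw [hmw, pow_one] at hid
    have hq0 : q ≠ 0 := by
      rintro rfl
      rw [Rat.cast_zero, zero_mul, zero_mul] at hLq
      exact hL0 hLq
    have h1 := hval V C hC hV Dm.f Dm.isNewformOf ϖ hϖ
    have hv : padicValRat 3 q + (padicRegulator Dh).valuation = 1 :=
      (exists_unit_mul_iff_padicValRat_add_valuation_eq_one h1 hq0 hReg0).mp ⟨u, hid⟩
    exact (hX.bsdp_three_iff_padicVal_rankOne_of_wuthrichHalf_of_cert hWu hmodD hGZK hmod hr hna hcert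
      hB hLq).mpr hv
  · intro hbsd
    obtain ⟨q, hLq⟩ := exists_leadingLCoeff_eq_of_bsdp hbsd
    have hq0 : q ≠ 0 := by
      rintro rfl
      rw [Rat.cast_zero, zero_mul, zero_mul] at hLq
      exact hL0 hLq
    have hv : padicValRat 3 q + (padicRegulator Dh).valuation = 1 :=
      (hX.bsdp_three_iff_padicVal_rankOne_of_wuthrichHalf_of_cert hWu hmodD hGZK hmod hr hna hcert hB
        hLq).mp hbsd
    intro V _ _ N _ f hp4 hVW hord hf ϖ hϖ
    obtain ⟨C, hC⟩ := hVW
    have hC' : C • V.quadraticTwist ((-1 : ℚ) ^ (3 / 2) * (3 : ℕ)) = W := by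
      have h := hC; norm_num at h ⊢; exact h
    have h1 := hval V C hC' hord f hf ϖ hϖ
    obtain ⟨u, hu⟩ := (exists_unit_mul_iff_padicValRat_add_valuation_eq_one h1 hq0 hReg0).mpr hv
    refine ⟨u, q, hLq, ?_⟩
    rw [hmw, pow_one]
    exact hu

end Three

/-! ### §2 The same rows with `hna` DISCHARGED to the census literal `¬ 3 ∣ a₃(E ⊗ χ₋₃) − 1`
(n1011-p10's B6 `ReductionNonAnomalousTwist`, Greenberg 1999 Prop. 3.7 bookkeeping, PROVED: at defect
`2` — automatic on `(G)` at `3` — `ReductionNonAnomalous W 3 ⟺ ¬ 3 ∣ a₃(V) − 1`, `V` any good model). -/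

section NotDvd

variable {W : WeierstrassCurve ℚ} [W.IsElliptic] [W.IsGloballyMinimal] [hp : Fact (Nat.Prime 3)]

/-- B6 at `3` on a `(G)`-row, twist literal `−3`: `ReductionNonAnomalous W 3` from `¬ 3 ∣ a₃(V) − 1`
for a good model `V` of `E ⊗ χ_{−3}` — NOT a second proof of B6: the ONE-LINE BRIDGE (`.mpr`) from
p10's `reductionNonAnomalous_iff_not_dvd_frobeniusTrace_sub_one_of_semistabilityIndex_eq_two` BY
NAME (p254456) with `semistabilityIndex_eq_two_of_typeG_three`. [cite: Greenberg1999LNM, Prop. 3.7] -/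
theorem reductionNonAnomalous_three_of_typeG_of_not_dvd (hG : TypeG W 3)
    (hadd : Addv W 3) (V : WeierstrassCurve ℚ) [V.IsElliptic] [V.IsGloballyMinimal]
    (hWV : ∃ C : VariableChange ℚ, C • V.quadraticTwist (-3) = W) (hV : V.HasGoodReductionAtPrime 3)
    (ha : ¬ (3 : ℤ) ∣ V.frobeniusTrace 3 - 1) : ReductionNonAnomalous W 3 := by
  have hWV' : ∃ C : VariableChange ℚ, C • V.quadraticTwist ((-1 : ℚ) ^ (3 / 2) * (3 : ℕ)) = W := by
    obtain ⟨C, hC⟩ := hWV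
    exact ⟨C, by have h := hC; norm_num at h ⊢; exact h⟩
  exact (reductionNonAnomalous_iff_not_dvd_frobeniusTrace_sub_one_of_semistabilityIndex_eq_two W 3
    (by decide) (semistabilityIndex_eq_two_of_typeG_three W hG hadd) V hWV' hV).mpr
    (by exact_mod_cast ha)

/-- **T-O7c (iii), census-literal form on X4♯(G-ord)@3**: as
`ClassX4Gord.branchPAdicGrossZagierOddAt_three_iff_bsdp_of_katoHalf_of_cert` with the non-anomalous
binder replaced by `¬ 3 ∣ a₃(V) − 1` for a good model `V` of `E ⊗ χ_{−3}` (p10's B6, one call).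
[cite: Delbourgo2002, Theorem (B) (p. 40)] [cite: Kato2004Asterisque, Thm. 17.4 (3) (p. 273)]
[cite: Greenberg1999LNM, Prop. 3.7] -/
theorem ClassX4Gord.branchPAdicGrossZagierOddAt_three_iff_bsdp_of_katoHalf_of_cert_of_not_dvd
    (hK : Wuthrich2014.kato_halfEigenCharIdeal_dvd_cyclotomicPrime_of_surjective)
    (hmodD : nonempty_modularParametrizationData)
    (hGZK : rank_eq_analyticRank_of_analyticRank_le_one) (hmod : hasEntireLFunction_rat)
    (hX : ClassX4Gord W 3) (hsurj : Surj W 3) (hr : W.analyticRank = 1)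
    (V : WeierstrassCurve ℚ) [V.IsElliptic] [V.IsGloballyMinimal]
    (hWV : ∃ C : VariableChange ℚ, C • V.quadraticTwist (-3) = W) (hV : V.HasGoodReductionAtPrime 3)
    (ha : ¬ (3 : ℤ) ∣ V.frobeniusTrace 3 - 1) (hcert : BranchUnitCertificateAt W 3)
    {Dh : PAdicHeightData W 3} (hB : LeadingTermClauses W 3 Dh) :
    BranchPAdicGrossZagierOddAt W 3 Dh ↔ BSDp W 3 :=
  hX.branchPAdicGrossZagierOddAt_three_iff_bsdp_of_katoHalf_of_cert hK hmodD hGZK hmod hsurj hr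
    (reductionNonAnomalous_three_of_typeG_of_not_dvd hX.typeGOrd.typeG hX.addv.2 V hWV hV ha) hcert hB

/-- **X3♯(G-ord)@3 twin, census-literal form** (Wuthrich Thm. 16 `hWu`; NO surj).
[cite: Delbourgo2002, Theorem (B) (p. 40)] [cite: Wuthrich2014, Thm. 16 (p. 397)]
[cite: Greenberg1999LNM, Prop. 3.7] -/
theorem ClassX3Gord.branchPAdicGrossZagierOddAt_three_iff_bsdp_of_wuthrichHalf_of_cert_of_not_dvd
    (hWu : Wuthrich2014.thm16_halfEigenCharIdeal_dvd_cyclotomicPrime)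
    (hmodD : nonempty_modularParametrizationData)
    (hGZK : rank_eq_analyticRank_of_analyticRank_le_one) (hmod : hasEntireLFunction_rat)
    (hX : ClassX3Gord W 3) (hr : W.analyticRank = 1)
    (V : WeierstrassCurve ℚ) [V.IsElliptic] [V.IsGloballyMinimal]
    (hWV : ∃ C : VariableChange ℚ, C • V.quadraticTwist (-3) = W) (hV : V.HasGoodReductionAtPrime 3)
    (ha : ¬ (3 : ℤ) ∣ V.frobeniusTrace 3 - 1) (hcert : BranchUnitCertificateAt W 3)
    {Dh : PAdicHeightData W 3} (hB : LeadingTermClauses W 3 Dh) :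
    BranchPAdicGrossZagierOddAt W 3 Dh ↔ BSDp W 3 :=
  hX.branchPAdicGrossZagierOddAt_three_iff_bsdp_of_wuthrichHalf_of_cert hWu hmodD hGZK hmod hr
    (reductionNonAnomalous_three_of_typeG_of_not_dvd hX.typeGOrd.typeG hX.addv V hWV hV ha) hcert hB

/-- **T-O7K3 headline, census-literal form on X4♯(G-ord)@3**: `BSD(E,3) ⟺ ord₃ q + ord₃ Reg₃ = 1`
(`ClassX4Gord.bsdp_three_iff_padicVal_rankOne_of_katoHalf_of_cert`) with `hna` replaced by
`¬ 3 ∣ a₃(V) − 1` (B6). [cite: Delbourgo2002, Theorem (B) (p. 40)]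
[cite: Kato2004Asterisque, Thm. 17.4 (3) (p. 273)] [cite: Greenberg1999LNM, Prop. 3.7] -/
theorem ClassX4Gord.bsdp_three_iff_padicVal_rankOne_of_katoHalf_of_cert_of_not_dvd
    (hK : Wuthrich2014.kato_halfEigenCharIdeal_dvd_cyclotomicPrime_of_surjective)
    (hmodD : nonempty_modularParametrizationData)
    (hGZK : rank_eq_analyticRank_of_analyticRank_le_one) (hmod : hasEntireLFunction_rat)
    (hX : ClassX4Gord W 3) (hsurj : Surj W 3) (hr : W.analyticRank = 1)
    (V : WeierstrassCurve ℚ) [V.IsElliptic] [V.IsGloballyMinimal]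
    (hWV : ∃ C : VariableChange ℚ, C • V.quadraticTwist (-3) = W) (hV : V.HasGoodReductionAtPrime 3)
    (ha : ¬ (3 : ℤ) ∣ V.frobeniusTrace 3 - 1) (hcert : BranchUnitCertificateAt W 3)
    {Dh : PAdicHeightData W 3} (hB : LeadingTermClauses W 3 Dh) {q : ℚ}
    (hLq : W.leadingLCoeff = (q : ℂ) * (W.realPeriodRat : ℂ) * (W.regulator : ℂ)) :
    BSDp W 3 ↔ padicValRat 3 q + (padicRegulator Dh).valuation = 1 :=
  hX.bsdp_three_iff_padicVal_rankOne_of_katoHalf_of_cert hK hmodD hGZK hmod hsurj hr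
    (reductionNonAnomalous_three_of_typeG_of_not_dvd hX.typeGOrd.typeG hX.addv.2 V hWV hV ha) hcert hB
    hLq

/-- **X3♯(G-ord)@3 twin of the headline, census-literal form** (Wuthrich Thm. 16; NO surj).
[cite: Delbourgo2002, Theorem (B) (p. 40)] [cite: Wuthrich2014, Thm. 16 (p. 397)]
[cite: Greenberg1999LNM, Prop. 3.7] -/
theorem ClassX3Gord.bsdp_three_iff_padicVal_rankOne_of_wuthrichHalf_of_cert_of_not_dvd
    (hWu : Wuthrich2014.thm16_halfEigenCharIdeal_dvd_cyclotomicPrime)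
    (hmodD : nonempty_modularParametrizationData)
    (hGZK : rank_eq_analyticRank_of_analyticRank_le_one) (hmod : hasEntireLFunction_rat)
    (hX : ClassX3Gord W 3) (hr : W.analyticRank = 1)
    (V : WeierstrassCurve ℚ) [V.IsElliptic] [V.IsGloballyMinimal]
    (hWV : ∃ C : VariableChange ℚ, C • V.quadraticTwist (-3) = W) (hV : V.HasGoodReductionAtPrime 3)
    (ha : ¬ (3 : ℤ) ∣ V.frobeniusTrace 3 - 1) (hcert : BranchUnitCertificateAt W 3)
    {Dh : PAdicHeightData W 3} (hB : LeadingTermClauses W 3 Dh) {q : ℚ}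
    (hLq : W.leadingLCoeff = (q : ℂ) * (W.realPeriodRat : ℂ) * (W.regulator : ℂ)) :
    BSDp W 3 ↔ padicValRat 3 q + (padicRegulator Dh).valuation = 1 :=
  hX.bsdp_three_iff_padicVal_rankOne_of_wuthrichHalf_of_cert hWu hmodD hGZK hmod hr
    (reductionNonAnomalous_three_of_typeG_of_not_dvd hX.typeGOrd.typeG hX.addv V hWV hV ha) hcert hB hLq

end NotDvd

end Summit.BirchSwinnertonDyer.Rank1Residual.Additive

end
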